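/-
Copyright: lead seat `ym-line-sll-p1` (prover-ym-line-sll-p1-g0-0), route `SoftLoopLongLag`, crux `ColdBoxSoftLoopLagFloor`
(stmt-QuantumFields-22503), line `birth` (ingredient (i) of the load-bearing stub `stub_anharmonicRemainderG`), part 2 of 2.
-/
import Summits.QuantumFields.YangMills.Theorems.SoftLoopLongLagHeatKernelPSD

/-!
# Free lattice Maxwell theory on `ℤ⁴`: the lag-`T` flux–flux form of spatial `(1,2)`-plaquettes is positive semidefinite
# (reflection positivity of the massless `1`-form field in the time direction)

WHAT.  For every finite family of sites `g j` in the time-zero hyperplane (`(g j) 0 = 0`), real weights `c j` and every lag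
`T : ℕ`,
  `0 ≤ Σ_{j,j'} c_j c_{j'} · curvatureTwoPoint (g j; 1,2) (g j' + T e₀; 1,2)`     (`sum_sum_mul_mul_curvatureTwoPoint_lag_nonneg`),
i.e. the free lattice-Maxwell covariance `Cov(X, α_T X)` of a smeared spatial flux `X = Σ_j c_j F₁₂(g j)` with its time translate is
non-negative — the lag-`T` autocovariance form is positive semidefinite in the weights.  Corollary for the route's objects
(`Theorems/SoftLoopLongLagDefs.lean`): `0 ≤ Σ_{x,x'} w_x w_{x'} · mutualInductance x (x' + T e₀) R` for all real weights `w` on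
`timeZeroCube R` (`sum_sum_mul_mul_mutualInductance_lag_nonneg`).

WHY (route `SoftLoopLongLag`, crux T′, stub S2 `stub_anharmonicRemainderG`, card `Cruxes/ColdBoxSoftLoopLagFloor/Lines/birth.md`): in the
Gaussian model of the cold-conditioned box kernel around a background with loop fluxes `b_ℓ`, the lag-`R` autocovariance of the soft-loop
sum has, besides the Wick term `½ Σ M²`, the BACKGROUND term `β Σ_{ℓ,ℓ'} sin b_ℓ sin b_{ℓ'+R} M(ℓ, ℓ'+R)`, LINEAR in the inductance and
dominant for coherent cold data; this file supplies the sign of its equal-weight part: it is `≥ 0` for ALL real weights.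

HOW (no Fourier analysis in the time variable).  (1) Parallel `(1,2)`-plaquettes: `curvatureTwoPoint = −[Δ₁ + Δ₂] latticeGreen / 2`
(transverse second differences; the sixteen `edgeGreen` pairs).  (2) The tree's heat-kernel representation
`latticeGreen z = ∫_0^∞ Π_i q_t(z_i) dt` (`latticeGreen_eq_integral_prod_srwHeatKernel`, `q_t = srwHeatKernel t` the rate-one
continuous-time walk on `ℤ`), so the lag-`T` kernel is `∫_0^∞ q_t(T) · ½{f_t ⊗ q_t ⊗ q_t + q_t ⊗ f_t ⊗ q_t}(spatial difference) dt` with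
`f_t(m) = 2q_t(m) − q_t(m+1) − q_t(m−1)`.  (3) `q_t` and `f_t` are positive semidefinite functions on `ℤ`: both are cosine transforms
`(2π)⁻¹ ∫_{−π}^{π} cos(km) ω(k) dk` of NON-NEGATIVE weights (`e^{−t(1−cos k)}` and `2(1 − cos k) e^{−t(1−cos k)}`), and
`Σ c_j c_{j'} cos(k(a_j − a_{j'})) = (Σ c_j cos(k a_j))² + (Σ c_j sin(k a_j))²`.  (4) Schur's product theorem (Mathlib
`Matrix.PosSemidef.hadamard`) for the tensor products over the three spatial coordinates; `q_t(T) ≥ 0`; integrate in `t`.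

HONEST LABEL.  A lemma of free lattice Maxwell theory serving a RECORD-label rung line (R2xi-G, leaf `WeakCouplingRates.XiPow` = an UPPER
bound on the lattice mass gap); NOT the Clay mass gap; no summit statement is touched.

References: J. Fröhlich, R. Israel, E. H. Lieb, B. Simon, CMP 62 (1978) §3 (reflection positivity of Gaussian / nearest-neighbour
lattice fields); C. Garban, A. Sepúlveda, IMRN 2023 §2.3 (the `1`-form GFF and its curvature); I. Schur, J. reine angew. Math. 140 (1911).
-/

set_option autoImplicit false

noncomputable section

open MeasureTheory Real Finset
open Literature.Probability.LatticeModels (Site srwHeatKernel latticeGreen latticeGreen_eq_integral_prod_srwHeatKernel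
  srwHeatKernel_neg)
open Literature.Probability.FitznerVanDerHofstad2017 (srwHeatKernel_nonneg)
open Literature.MathematicalPhysics.QuantumLattice (ZdPlaquette)
open Literature.MathematicalPhysics.QuantumFieldTheory (curvatureTwoPoint plaquetteBoundary plaquetteBoundarySign edgeGreen
  edgeGreen_apply)

namespace Summit.QuantumFields.YangMills.Theorems.SoftLoopLongLag

/-! ### §4. The lag-`T` curvature kernel through the heat-kernel representation -/

/-- Parallel `(1,2)`-plaquettes: the curvature two-point kernel is minus half the transverse second difference of `latticeGreen`
(of the sixteen boundary-edge pairs only the eight same-direction pairs contribute). -/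
theorem curvatureTwoPoint_plane12_eq (x y : Site 4) :
    curvatureTwoPoint ((x, plane12) : ZdPlaquette 4) (y, plane12) =
      -((latticeGreen (x - y + Pi.single 1 1) + latticeGreen (x - y - Pi.single 1 1) - 2 * latticeGreen (x - y)) +
          (latticeGreen (x - y + Pi.single 2 1) + latticeGreen (x - y - Pi.single 2 1) - 2 * latticeGreen (x - y))) / 2 := by
  have hne : (1 : Fin 4) ≠ 2 := by decide
  have hne' : (2 : Fin 4) ≠ 1 := by decide
  simp only [plane12, curvatureTwoPoint, Fin.sum_univ_four, plaquetteBoundary, plaquetteBoundarySign, edgeGreen_apply,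
    Matrix.cons_val_zero, Matrix.cons_val_one, Matrix.cons_val, if_true, hne, hne', if_false]
  have e1 : x - (y + Pi.single 2 1) = x - y - Pi.single 2 1 := by abel
  have e2 : x + Pi.single 2 1 - y = x - y + Pi.single 2 1 := by abel
  have e3 : x + Pi.single 2 1 - (y + Pi.single 2 1) = x - y := by abel
  have e4 : x + Pi.single 1 1 - (y + Pi.single 1 1) = x - y := by abel
  have e5 : x + Pi.single 1 1 - y = x - y + Pi.single 1 1 := by abel
  have e6 : x - (y + Pi.single 1 1) = x - y - Pi.single 1 1 := by abel
  simp only [e1, e2, e3, e4, e5, e6]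
  ring

/-- The heat-kernel representation of `latticeGreen` on `ℤ⁴`, with the product written out. -/
theorem latticeGreen_four_eq_integral (z : Site 4) :
    IntegrableOn (fun t : ℝ => srwHeatKernel t (z 0) * srwHeatKernel t (z 1) * srwHeatKernel t (z 2) * srwHeatKernel t (z 3))
        (Set.Ioi 0) ∧
      latticeGreen z = ∫ t in Set.Ioi (0 : ℝ),
        srwHeatKernel t (z 0) * srwHeatKernel t (z 1) * srwHeatKernel t (z 2) * srwHeatKernel t (z 3) := by
  obtain ⟨hi, hv⟩ := latticeGreen_eq_integral_prod_srwHeatKernel (by norm_num : 3 ≤ 4) z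
  simp only [Fin.prod_univ_four] at hi hv
  exact ⟨hi, hv⟩

/-- The spatial lag kernel at heat-time `t` for a difference vector `z` (coordinates `1, 2, 3`). -/
def spatialKernel (t : ℝ) (z : Site 4) : ℝ :=
  (srwHeatKernelNegLap t (z 1) * srwHeatKernel t (z 2) * srwHeatKernel t (z 3) +
    srwHeatKernel t (z 1) * srwHeatKernelNegLap t (z 2) * srwHeatKernel t (z 3)) / 2

/-- **Minus half the transverse second difference of `latticeGreen` on `ℤ⁴` through the heat kernel**: for every `z`,
`t ↦ q_t(z₀) K_t(z)` is integrable on `(0, ∞)` and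
`−[(Δ₁ + Δ₂) latticeGreen](z)/2 = ∫_0^∞ q_t(z₀) K_t(z) dt`. -/
theorem transverseLap_latticeGreen_eq_integral (z : Site 4) :
    IntegrableOn (fun t : ℝ => srwHeatKernel t (z 0) * spatialKernel t z) (Set.Ioi 0) ∧
      -((latticeGreen (z + Pi.single 1 1) + latticeGreen (z - Pi.single 1 1) - 2 * latticeGreen z) +
          (latticeGreen (z + Pi.single 2 1) + latticeGreen (z - Pi.single 2 1) - 2 * latticeGreen z)) / 2 =
        ∫ t in Set.Ioi (0 : ℝ), srwHeatKernel t (z 0) * spatialKernel t z := by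
  obtain ⟨I0, G0⟩ := latticeGreen_four_eq_integral z
  obtain ⟨I1p, G1p⟩ := latticeGreen_four_eq_integral (z + Pi.single 1 1)
  obtain ⟨I1m, G1m⟩ := latticeGreen_four_eq_integral (z - Pi.single 1 1)
  obtain ⟨I2p, G2p⟩ := latticeGreen_four_eq_integral (z + Pi.single 2 1)
  obtain ⟨I2m, G2m⟩ := latticeGreen_four_eq_integral (z - Pi.single 2 1)
  have h01 : (0 : Fin 4) ≠ 1 := by decide
  have h21 : (2 : Fin 4) ≠ 1 := by decide
  have h31 : (3 : Fin 4) ≠ 1 := by decide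
  have h02 : (0 : Fin 4) ≠ 2 := by decide
  have h12 : (1 : Fin 4) ≠ 2 := by decide
  have h32 : (3 : Fin 4) ≠ 2 := by decide
  simp only [Pi.add_apply, Pi.sub_apply, Pi.single_eq_same, Pi.single_eq_of_ne h01, Pi.single_eq_of_ne h21,
    Pi.single_eq_of_ne h31, Pi.single_eq_of_ne h02, Pi.single_eq_of_ne h12, Pi.single_eq_of_ne h32, add_zero, sub_zero]
    at I1p G1p I1m G1m I2p G2p I2m G2m
  set μ : Measure ℝ := volume.restrict (Set.Ioi 0) with hμ
  set P0 : ℝ → ℝ := fun t => srwHeatKernel t (z 0) * srwHeatKernel t (z 1) * srwHeatKernel t (z 2) * srwHeatKernel t (z 3)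
    with hP0
  set P1p : ℝ → ℝ := fun t =>
    srwHeatKernel t (z 0) * srwHeatKernel t (z 1 + 1) * srwHeatKernel t (z 2) * srwHeatKernel t (z 3) with hP1p
  set P1m : ℝ → ℝ := fun t =>
    srwHeatKernel t (z 0) * srwHeatKernel t (z 1 - 1) * srwHeatKernel t (z 2) * srwHeatKernel t (z 3) with hP1m
  set P2p : ℝ → ℝ := fun t =>
    srwHeatKernel t (z 0) * srwHeatKernel t (z 1) * srwHeatKernel t (z 2 + 1) * srwHeatKernel t (z 3) with hP2p
  set P2m : ℝ → ℝ := fun t =>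
    srwHeatKernel t (z 0) * srwHeatKernel t (z 1) * srwHeatKernel t (z 2 - 1) * srwHeatKernel t (z 3) with hP2m
  -- the pointwise identity between the combination of four-fold products and `q_t(z₀) K_t(z)`
  have key : ∀ t : ℝ, -((P1p t + P1m t - 2 * P0 t) + (P2p t + P2m t - 2 * P0 t)) / 2 =
      srwHeatKernel t (z 0) * spatialKernel t z := by
    intro t
    simp only [hP0, hP1p, hP1m, hP2p, hP2m, spatialKernel, srwHeatKernelNegLap]
    ring
  -- integrability facts, with explicit integrands
  have IA : Integrable (fun t => P1p t + P1m t - 2 * P0 t) μ := (I1p.add I1m).sub (I0.const_mul 2)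
  have IB : Integrable (fun t => P2p t + P2m t - 2 * P0 t) μ := (I2p.add I2m).sub (I0.const_mul 2)
  have Iall : Integrable (fun t => -((P1p t + P1m t - 2 * P0 t) + (P2p t + P2m t - 2 * P0 t)) / 2) μ :=
    ((IA.add IB).neg).div_const 2
  have Icomb : IntegrableOn (fun t : ℝ => srwHeatKernel t (z 0) * spatialKernel t z) (Set.Ioi 0) :=
    Iall.congr (ae_of_all _ key)
  refine ⟨Icomb, ?_⟩
  -- the integral identities
  have eA : ∫ t, (P1p t + P1m t - 2 * P0 t) ∂μ = ∫ t, (P1p t + P1m t) ∂μ - ∫ t, 2 * P0 t ∂μ :=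
    integral_sub (I1p.add I1m) (I0.const_mul 2)
  have eB : ∫ t, (P2p t + P2m t - 2 * P0 t) ∂μ = ∫ t, (P2p t + P2m t) ∂μ - ∫ t, 2 * P0 t ∂μ :=
    integral_sub (I2p.add I2m) (I0.const_mul 2)
  have eA2 : ∫ t, (P1p t + P1m t) ∂μ = ∫ t, P1p t ∂μ + ∫ t, P1m t ∂μ := integral_add I1p I1m
  have eB2 : ∫ t, (P2p t + P2m t) ∂μ = ∫ t, P2p t ∂μ + ∫ t, P2m t ∂μ := integral_add I2p I2m
  have eP0 : ∫ t, 2 * P0 t ∂μ = 2 * ∫ t, P0 t ∂μ := integral_const_mul 2 P0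
  have eAB : ∫ t, ((P1p t + P1m t - 2 * P0 t) + (P2p t + P2m t - 2 * P0 t)) ∂μ =
      ∫ t, (P1p t + P1m t - 2 * P0 t) ∂μ + ∫ t, (P2p t + P2m t - 2 * P0 t) ∂μ := integral_add IA IB
  have eTot : ∫ t, -((P1p t + P1m t - 2 * P0 t) + (P2p t + P2m t - 2 * P0 t)) / 2 ∂μ =
      -(∫ t, ((P1p t + P1m t - 2 * P0 t) + (P2p t + P2m t - 2 * P0 t)) ∂μ) / 2 := by
    rw [integral_div, integral_neg]
  rw [G0, G1p, G1m, G2p, G2m, ← integral_congr_ae (ae_of_all μ key), eTot, eAB, eA, eB, eA2, eB2, eP0]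

/-- **The lag-`T` curvature kernel between `(1,2)`-plaquettes at time-zero sites `x` and `y + T e₀` through the heat kernel**:
`curvatureTwoPoint (x;1,2) (y + Te₀;1,2) = ∫_0^∞ q_t(T) · K_t(x − y) dt`, `K_t` the spatial kernel (coordinates `1, 2, 3` of `x − y`). -/
theorem curvatureTwoPoint_lag_eq_integral {x y : Site 4} (hx : x 0 = 0) (hy : y 0 = 0) (T : ℕ) :
    IntegrableOn (fun t : ℝ => srwHeatKernel t T * spatialKernel t (x - y)) (Set.Ioi 0) ∧
      curvatureTwoPoint ((x, plane12) : ZdPlaquette 4)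
          (y + Pi.single 0 (T : ℤ), plane12) =
        ∫ t in Set.Ioi (0 : ℝ), srwHeatKernel t T * spatialKernel t (x - y) := by
  set z : Site 4 := x - (y + Pi.single 0 (T : ℤ)) with hz
  obtain ⟨hI, hG⟩ := transverseLap_latticeGreen_eq_integral z
  have hz0 : z 0 = -(T : ℤ) := by simp [hz, hx, hy]
  have hK : ∀ t, spatialKernel t z = spatialKernel t (x - y) := fun t => by
    simp only [spatialKernel, hz, Pi.sub_apply, Pi.add_apply, Pi.single_eq_of_ne (show (1 : Fin 4) ≠ 0 by decide),
      Pi.single_eq_of_ne (show (2 : Fin 4) ≠ 0 by decide), Pi.single_eq_of_ne (show (3 : Fin 4) ≠ 0 by decide), add_zero]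
  have hfun : (fun t : ℝ => srwHeatKernel t (z 0) * spatialKernel t z) = fun t => srwHeatKernel t T * spatialKernel t (x - y) := by
    funext t
    rw [hz0, srwHeatKernel_neg, hK]
  rw [hfun] at hI hG
  refine ⟨hI, ?_⟩
  rw [curvatureTwoPoint_plane12_eq, ← hG]

/-! ### §5. The theorem -/

/-- Reindexing a double `Finset` sum as a double sum over the subtype (with an ABSTRACT summand, so that the rewrite is cheap). -/
theorem sum_sum_coe_sort_eq {ι : Type*} (s : Finset ι) (F : ι → ι → ℝ) :
    ∑ j : ↥s, ∑ j' : ↥s, F j j' = ∑ j ∈ s, ∑ j' ∈ s, F j j' := by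
  rw [Finset.sum_coe_sort s (fun j => ∑ j' : ↥s, F j j')]
  exact Finset.sum_congr rfl fun j _ => Finset.sum_coe_sort s (F j)

/-- **Lag positivity of free lattice Maxwell theory.**  For every finite family of time-zero sites `g j`, `j ∈ s` (`(g j) 0 = 0`), real
weights `c j` and lag `T`, `0 ≤ Σ_{j,j' ∈ s} c_j c_{j'} · curvatureTwoPoint (g j; 1,2) (g j' + T e₀; 1,2)`: the covariance of a smeared
spatial flux with its time translate is non-negative (reflection positivity of the massless `1`-form field in the time direction). -/
theorem sum_sum_mul_mul_curvatureTwoPoint_lag_nonneg {ι : Type*} (s : Finset ι) (g : ι → Site 4) (hg : ∀ j ∈ s, g j 0 = 0)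
    (c : ι → ℝ) (T : ℕ) :
    0 ≤ ∑ j ∈ s, ∑ j' ∈ s, c j * c j' *
      curvatureTwoPoint ((g j, plane12) : ZdPlaquette 4) (g j' + Pi.single 0 (T : ℤ), plane12) := by
  have hrep : ∀ j ∈ s, ∀ j' ∈ s, curvatureTwoPoint ((g j, plane12) : ZdPlaquette 4) (g j' + Pi.single 0 (T : ℤ), plane12) =
      ∫ t in Set.Ioi (0 : ℝ), srwHeatKernel t T * spatialKernel t (g j - g j') := fun j hj j' hj' =>
    (curvatureTwoPoint_lag_eq_integral (hg j hj) (hg j' hj') T).2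
  have hint : ∀ j ∈ s, ∀ j' ∈ s, Integrable (fun t : ℝ => c j * c j' * (srwHeatKernel t T * spatialKernel t (g j - g j')))
      (volume.restrict (Set.Ioi 0)) := fun j hj j' hj' =>
    (curvatureTwoPoint_lag_eq_integral (hg j hj) (hg j' hj') T).1.const_mul _
  -- replace each kernel value by its heat-kernel integral
  have hstep : ∑ j ∈ s, ∑ j' ∈ s, c j * c j' *
      curvatureTwoPoint ((g j, plane12) : ZdPlaquette 4) (g j' + Pi.single 0 (T : ℤ), plane12) =
      ∑ j ∈ s, ∑ j' ∈ s, c j * c j' * ∫ t in Set.Ioi (0 : ℝ), srwHeatKernel t T * spatialKernel t (g j - g j') :=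
    Finset.sum_congr rfl fun j hj => Finset.sum_congr rfl fun j' hj' => by rw [hrep j hj j' hj']
  -- swap the finite sums with the `t`-integral
  have hswap : ∑ j ∈ s, ∑ j' ∈ s, c j * c j' * ∫ t in Set.Ioi (0 : ℝ), srwHeatKernel t T * spatialKernel t (g j - g j') =
      ∫ t in Set.Ioi (0 : ℝ), ∑ j ∈ s, ∑ j' ∈ s, c j * c j' * (srwHeatKernel t T * spatialKernel t (g j - g j')) := by
    rw [integral_finsetSum _ (fun j hj => integrable_finsetSum _ fun j' hj' => hint j hj j' hj')]
    refine Finset.sum_congr rfl fun j hj => ?_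
    rw [integral_finsetSum _ (fun j' hj' => hint j hj j' hj')]
    refine Finset.sum_congr rfl fun j' _ => ?_
    rw [integral_const_mul]
  rw [hstep, hswap]
  refine setIntegral_nonneg measurableSet_Ioi fun t ht => ?_
  -- pointwise in `t`: `q_t(T) ≥ 0` times the positive semidefinite spatial form (summed over the subtype `↥s`)
  have hK : 0 ≤ ∑ j ∈ s, ∑ j' ∈ s, c j * c j' *
      ((srwHeatKernelNegLap t (g j 1 - g j' 1) * srwHeatKernel t (g j 2 - g j' 2) * srwHeatKernel t (g j 3 - g j' 3) +
        srwHeatKernel t (g j 1 - g j' 1) * srwHeatKernelNegLap t (g j 2 - g j' 2) * srwHeatKernel t (g j 3 - g j' 3)) / 2) :=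
    (sum_sum_mul_mul_spatialKernel_nonneg t (fun j : ↥s => g j) (fun j => c j)).trans_eq
      (sum_sum_coe_sort_eq s (fun j j' => c j * c j' *
        ((srwHeatKernelNegLap t (g j 1 - g j' 1) * srwHeatKernel t (g j 2 - g j' 2) * srwHeatKernel t (g j 3 - g j' 3) +
          srwHeatKernel t (g j 1 - g j' 1) * srwHeatKernelNegLap t (g j 2 - g j' 2) * srwHeatKernel t (g j 3 - g j' 3)) / 2)))
  have hpos := mul_nonneg (srwHeatKernel_nonneg (le_of_lt ht) (T : ℤ)) hK
  rw [Finset.mul_sum] at hpos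
  refine hpos.trans_eq (Finset.sum_congr rfl fun j _ => ?_)
  rw [Finset.mul_sum]
  refine Finset.sum_congr rfl fun j' _ => ?_
  simp only [spatialKernel, Pi.sub_apply]
  ring

/-! ### §6. Corollary for the route's objects: the lag-`T` mutual-inductance form of the soft-loop cube is positive semidefinite -/

/-- Sums over the spanning surface `rectSurface x R T` are sums over the parameter rectangle `range R × range T`
(the parametrisation `(a, b) ↦ (x + a e₁ + b e₂; 1, 2)` is injective). -/
theorem sum_rectSurface_eq_sum_product (x : Site 4) (R T : ℕ) (h : ZdPlaquette 4 → ℝ) :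
    ∑ p ∈ rectSurface x R T, h p =
      ∑ ab ∈ Finset.range R ×ˢ Finset.range T,
        h ((x + Pi.single 1 (ab.1 : ℤ) + Pi.single 2 (ab.2 : ℤ), plane12) : ZdPlaquette 4) := by
  unfold rectSurface
  refine Finset.sum_image fun ab _ cd _ hEq => ?_
  have hsite := congrArg Prod.fst hEq
  have h1 := congrFun hsite 1
  have h2 := congrFun hsite 2
  simp only [Pi.add_apply, Pi.single_eq_same, Pi.single_eq_of_ne (show (1 : Fin 4) ≠ 2 by decide),
    Pi.single_eq_of_ne (show (2 : Fin 4) ≠ 1 by decide), add_zero, add_right_inj, Nat.cast_inj] at h1 h2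
  exact Prod.ext h1 h2

/-- **The lag-`T` mutual-inductance form is positive semidefinite**: for all real weights `w` on the time-zero cube and every lag `T`,
`0 ≤ Σ_{x,x' ∈ timeZeroCube R} w_x w_{x'} · mutualInductance x (x' + T e₀) R` — the free lattice-Maxwell covariance of the weighted
coil flux `Σ_x w_x Φ_x` with its time translate is non-negative (the equal-weight part of the background term of the T′ line). -/
theorem sum_sum_mul_mul_mutualInductance_lag_nonneg (R T : ℕ) (w : Site 4 → ℝ) :
    0 ≤ ∑ x ∈ timeZeroCube R, ∑ x' ∈ timeZeroCube R, w x * w x' * mutualInductance x (x' + Pi.single 0 (T : ℤ)) R := by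
  -- index set `timeZeroCube R × (range R × range R)`: (base point, surface parameter)
  have hg0 : ∀ j ∈ timeZeroCube R ×ˢ (Finset.range R ×ˢ Finset.range R),
      (j.1 + Pi.single 1 (j.2.1 : ℤ) + Pi.single 2 (j.2.2 : ℤ) : Site 4) 0 = 0 := fun j hj => by
    have hx0 : (j.1 : Site 4) 0 = 0 := (Finset.mem_filter.1 (Finset.mem_product.1 hj).1).2
    simp only [Pi.add_apply, hx0, Pi.single_eq_of_ne (show (0 : Fin 4) ≠ 1 by decide),
      Pi.single_eq_of_ne (show (0 : Fin 4) ≠ 2 by decide), add_zero]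
  have hmain := sum_sum_mul_mul_curvatureTwoPoint_lag_nonneg (timeZeroCube R ×ˢ (Finset.range R ×ˢ Finset.range R))
    (fun j => (j.1 + Pi.single 1 (j.2.1 : ℤ) + Pi.single 2 (j.2.2 : ℤ) : Site 4)) hg0 (fun j => w j.1) T
  -- the route's double sum, expanded over (base point, surface parameter) pairs
  have hexp : ∑ x ∈ timeZeroCube R, ∑ x' ∈ timeZeroCube R, w x * w x' * mutualInductance x (x' + Pi.single 0 (T : ℤ)) R =
      ∑ j ∈ timeZeroCube R ×ˢ (Finset.range R ×ˢ Finset.range R),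
        ∑ j' ∈ timeZeroCube R ×ˢ (Finset.range R ×ˢ Finset.range R), w j.1 * w j'.1 *
          curvatureTwoPoint
            (((j.1 + Pi.single 1 (j.2.1 : ℤ) + Pi.single 2 (j.2.2 : ℤ) : Site 4), plane12) :
              ZdPlaquette 4)
            ((j'.1 + Pi.single 1 (j'.2.1 : ℤ) + Pi.single 2 (j'.2.2 : ℤ) : Site 4) + Pi.single 0 (T : ℤ),
              plane12) := by
    rw [Finset.sum_product]
    refine Finset.sum_congr rfl fun x _ => ?_
    rw [Finset.sum_comm, Finset.sum_product]
    refine Finset.sum_congr rfl fun x' _ => ?_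
    rw [mutualInductance, sum_rectSurface_eq_sum_product, Finset.mul_sum, Finset.sum_comm]
    refine Finset.sum_congr rfl fun ab _ => ?_
    rw [sum_rectSurface_eq_sum_product, Finset.mul_sum]
    refine Finset.sum_congr rfl fun cd _ => ?_
    have hsite : x' + Pi.single 0 (T : ℤ) + Pi.single 1 (cd.1 : ℤ) + Pi.single 2 (cd.2 : ℤ) =
        x' + Pi.single 1 (cd.1 : ℤ) + Pi.single 2 (cd.2 : ℤ) + Pi.single 0 (T : ℤ) := by abel
    rw [hsite]
  rw [hexp]
  exact hmain

end Summit.QuantumFields.YangMills.Theorems.SoftLoopLongLag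

end
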